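import Mathlib
import Summits.Ventures.PercRepro2.Defs
import Summits.Ventures.PercRepro2.Graph
import Summits.Ventures.PercRepro2.OneColourSwitch
import Summits.Ventures.PercRepro2.RegionHubSign
import Summits.Ventures.PercRepro2.SideSwitch
import Summits.Ventures.PercRepro2.SideSwitchFibre
import Summits.Ventures.PercRepro2.SideSwitchMono
import Summits.Ventures.PercRepro2.SideSwitchClosed
import Summits.Ventures.PercRepro2.SideSwitchComps
import Summits.Ventures.PercRepro2.SideSwitchCompsFibre
import Summits.Ventures.PercRepro2.M9NoPocketDefs
import Summits.Ventures.PercRepro2.M9NoPocketWorld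
import Summits.Ventures.PercRepro2.M9NoPocketWorldD
import Summits.Ventures.PercRepro2.M9NoPocketLegal
import Summits.Ventures.PercRepro2.M9NoPocketCompl

/-!
# The single-`d` class without a pocket — `r ~ s` is blind to the outside flip (blind cell
PercRepro2, p3 g20, 2026-08-27; `proofs/P3-CPNC.md` §17c (vi))

In a legal assignment the only vertex of the unexplored part of `G − d` that the worlds of
`{r, s}` reach is `d` itself (`eq_d_of_mem_Oprime_of_mem_K2`, `eq_d_of_mem_Oprime_of_mem_M2`),
and an edge inside the unexplored part at `d` is a loop (`eq_of_within_Oprime_d`, no pocket);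
so a path from `r` never uses an edge inside that part, and `σ_rs` of the assignment of the
outside-flipped representative is `σ_rs` of the assignment (`sigma_rs_assignX_flipOp`).
Own work; std axioms.
-/

namespace Summit.Ventures.PercRepro2

namespace NoPocket

open Finset Classical RegionHub OneColourSwitch SideSwitch

variable {V : Type*} {E : Type*}

section FlipRS

variable [Fintype V] [DecidableEq V] [Fintype E] [DecidableEq E]

variable {ends : E → Sym2 V}

/-- A vertex of `Oprime` is `d` or outside the `Y`-world of `G` of a legal assignment. -/
lemma eq_d_of_mem_Oprime_of_mem_K2 {p q r s d : V} (hnp : NoPocketAt ends d r s) (hr : d ≠ r)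
    (hs : d ≠ s) {ρ : Config E} (hρ : ρ ∈ RepD ends p q r s d)
    {x : Finset (Finset V) × Finset E} (hx : x ∈ L4 ends d r s ρ) {y : V}
    (hyO : y ∈ Oprime ends d r s ρ) (hyK : y ∈ K2 ends r s (assignX ends x ρ)) : y = d := by
  obtain ⟨⟨hT, hF⟩, _, hLY⟩ := mem_L4.1 hx
  rw [K2_assignX hnp hρ hT hF hr hs hLY] at hyK
  rcases hyK with hyK | ⟨hyd, _⟩
  · rw [K2_endsD_assignX hρ hT hF] at hyK
    exact ((mem_Oprime.1 hyO).1 hyK.1).elim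
  · exact hyd

/-- A vertex of `Oprime` is `d` or outside the `W`-world of `G` of a legal assignment. -/
lemma eq_d_of_mem_Oprime_of_mem_M2 {p q r s d : V} (hnp : NoPocketAt ends d r s) (hr : d ≠ r)
    (hs : d ≠ s) {ρ : Config E} (hρ : ρ ∈ RepD ends p q r s d)
    {x : Finset (Finset V) × Finset E} (hx : x ∈ L4 ends d r s ρ) {y : V}
    (hyO : y ∈ Oprime ends d r s ρ) (hyM : y ∈ M2 ends r s (assignX ends x ρ)) : y = d := by
  obtain ⟨⟨hT, hF⟩, hLW, _⟩ := mem_L4.1 hx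
  rw [M2_assignX hnp hρ hT hF hr hs hLW] at hyM
  rcases hyM with hyM | ⟨hyd, _⟩
  · rw [M2_endsD_assignX hρ hT hF] at hyM
    obtain ⟨hyK', hyM'⟩ := mem_Oprime.1 hyO
    rcases hyM with h | h
    · exact (hyM' h).elim
    · exact (hyK' (unionT_subset_K2_endsD hρ hT h)).elim
  · exact hyd

omit [Fintype V] [Fintype E] [DecidableEq E] in
/-- An edge inside `Oprime` with an endpoint `d` is a loop (no pocket). -/
lemma eq_of_within_Oprime_d {d r s : V} (hnp : NoPocketAt ends d r s) (hr : d ≠ r) (hs : d ≠ s)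
    (ρ : Config E) {e : E} {z : V} (he : ends e = s(d, z))
    (hw : e ∈ within ends (Oprime ends d r s ρ)) : z = d := by
  by_contra hzd
  obtain ⟨a, ha, b, hb, hab⟩ := hw
  have hzO : z ∈ Oprime ends d r s ρ := by
    rw [he, Sym2.eq_iff] at hab
    rcases hab with ⟨_, h2⟩ | ⟨_, h2⟩
    · rw [← h2] at hb; exact hb
    · rw [← h2] at ha; exact ha
  have hzr : z ≠ r := fun h => (mem_Oprime.1 hzO).1 (by rw [h]; exact r_mem_K2 r s ρ)
  have hzs : z ≠ s := fun h => (mem_Oprime.1 hzO).1 (by rw [h]; exact s_mem_K2 r s ρ)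
  rcases neighbour_mem_worlds hnp hr hs ρ he hzd hzr hzs with h | h
  · exact (mem_Oprime.1 hzO).1 h
  · exact (mem_Oprime.1 hzO).2 h

/-- `r ~_Y s` in a legal assignment survives the flip of the edges inside `Oprime`. -/
lemma conn_rs_flipIn_Oprime_of_conn {p q r s d : V} (hnp : NoPocketAt ends d r s) (hr : d ≠ r)
    (hs : d ≠ s) {ρ : Config E} (hρ : ρ ∈ RepD ends p q r s d)
    {x : Finset (Finset V) × Finset E} (hx : x ∈ L4 ends d r s ρ)
    (hc : Conn ends (assignX ends x ρ) r s) :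
    Conn ends (flipIn ends (Oprime ends d r s ρ) (assignX ends x ρ)) r s := by
  set ω := assignX ends x ρ with hω
  set ω' := flipIn ends (Oprime ends d r s ρ) ω with hω'
  have key : s ∈ {w | Conn ends ω r w ∧ Conn ends ω' r w} := by
    refine mem_of_conn_of_closed (ends := ends) (ω := ω) ?_ ⟨conn_refl _ _ _, conn_refl _ _ _⟩ hc
    rintro a ⟨ha, ha'⟩ b hab
    obtain ⟨hne, e, he, hends⟩ := openGraph_adj.1 hab
    refine ⟨conn_trans ha (conn_of_openAdj ⟨e, he, hends⟩), ?_⟩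
    have hnot : e ∉ within ends (Oprime ends d r s ρ) := by
      intro hw
      have haO : a ∈ Oprime ends d r s ρ := by
        obtain ⟨u, hu, v, hv, huv⟩ := hw
        rw [hends, Sym2.eq_iff] at huv
        rcases huv with ⟨h1, _⟩ | ⟨h1, _⟩
        · rw [h1]; exact hu
        · rw [h1]; exact hv
      have had : a = d := eq_d_of_mem_Oprime_of_mem_K2 hnp hr hs hρ hx haO
        (mem_K2_iff.2 (Or.inl ha))
      rw [had] at hends hne
      exact hne (eq_of_within_Oprime_d hnp hr hs ρ hends hw).symm
    refine conn_trans ha' (conn_of_openAdj ⟨e, ?_, hends⟩)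
    rw [hω', flipIn_of_notMem hnot]
    exact he
  exact key.2

/-- `r ~_W s` in a legal assignment survives the flip of the edges inside `Oprime`. -/
lemma conn_rs_compl_flipIn_Oprime_of_conn {p q r s d : V} (hnp : NoPocketAt ends d r s)
    (hr : d ≠ r) (hs : d ≠ s) {ρ : Config E} (hρ : ρ ∈ RepD ends p q r s d)
    {x : Finset (Finset V) × Finset E} (hx : x ∈ L4 ends d r s ρ)
    (hc : Conn ends (OneColourSwitch.compl (assignX ends x ρ)) r s) :
    Conn ends (OneColourSwitch.compl (flipIn ends (Oprime ends d r s ρ) (assignX ends x ρ))) r s := by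
  set ω := OneColourSwitch.compl (assignX ends x ρ) with hω
  rw [compl_flipIn]
  set ω' := flipIn ends (Oprime ends d r s ρ) ω with hω'
  have key : s ∈ {w | Conn ends ω r w ∧ Conn ends ω' r w} := by
    refine mem_of_conn_of_closed (ends := ends) (ω := ω) ?_ ⟨conn_refl _ _ _, conn_refl _ _ _⟩ hc
    rintro a ⟨ha, ha'⟩ b hab
    obtain ⟨hne, e, he, hends⟩ := openGraph_adj.1 hab
    refine ⟨conn_trans ha (conn_of_openAdj ⟨e, he, hends⟩), ?_⟩
    have hnot : e ∉ within ends (Oprime ends d r s ρ) := by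
      intro hw
      have haO : a ∈ Oprime ends d r s ρ := by
        obtain ⟨u, hu, v, hv, huv⟩ := hw
        rw [hends, Sym2.eq_iff] at huv
        rcases huv with ⟨h1, _⟩ | ⟨h1, _⟩
        · rw [h1]; exact hu
        · rw [h1]; exact hv
      have had : a = d := eq_d_of_mem_Oprime_of_mem_M2 hnp hr hs hρ hx haO
        (mem_M2_iff.2 (Or.inl ha))
      rw [had] at hends hne
      exact hne (eq_of_within_Oprime_d hnp hr hs ρ hends hw).symm
    refine conn_trans ha' (conn_of_openAdj ⟨e, ?_, hends⟩)
    rw [hω', flipIn_of_notMem hnot]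
    exact he
  exact key.2

/-- `σ_rs` of the assignment of the outside-flipped representative is `σ_rs` of the
assignment. -/
theorem sigma_rs_assignX_flipOp {p q r s d : V} (hnp : NoPocketAt ends d r s) (hr : d ≠ r)
    (hs : d ≠ s) {ρ : Config E} (hρ : ρ ∈ RepD ends p q r s d)
    {x : Finset (Finset V) × Finset E} (hx : x ∈ L4 ends d r s ρ) :
    sigma ends (assignX ends x (flipOp ends d r s ρ)) r s = sigma ends (assignX ends x ρ) r s := by
  have hρO := flipOp_mem_RepD hr hs hρ
  have hxO : x ∈ L4 ends d r s (flipOp ends d r s ρ) := by rw [L4_flipOp hr hs]; exact hx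
  have h1 : Conn ends (assignX ends x (flipOp ends d r s ρ)) r s ↔
      Conn ends (assignX ends x ρ) r s := by
    constructor
    · intro h
      have := conn_rs_flipIn_Oprime_of_conn hnp hr hs hρO hxO h
      rwa [assignX_flipOp, Oprime_flipOp hr hs, flipIn_flipIn] at this
    · intro h
      rw [assignX_flipOp]
      exact conn_rs_flipIn_Oprime_of_conn hnp hr hs hρ hx h
  have h2 : Conn ends (OneColourSwitch.compl (assignX ends x (flipOp ends d r s ρ))) r s ↔
      Conn ends (OneColourSwitch.compl (assignX ends x ρ)) r s := by
    constructor
    · intro h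
      have := conn_rs_compl_flipIn_Oprime_of_conn hnp hr hs hρO hxO h
      rwa [assignX_flipOp, Oprime_flipOp hr hs, flipIn_flipIn] at this
    · intro h
      rw [assignX_flipOp]
      exact conn_rs_compl_flipIn_Oprime_of_conn hnp hr hs hρ hx h
  unfold sigma
  by_cases ha : Conn ends (assignX ends x ρ) r s <;>
    by_cases hb : Conn ends (OneColourSwitch.compl (assignX ends x ρ)) r s
  · have ha' := h1.2 ha
    have hb' := h2.2 hb
    simp [ha, hb, ha', hb']
  · have ha' := h1.2 ha
    have hb' : ¬ Conn ends (OneColourSwitch.compl (assignX ends x (flipOp ends d r s ρ))) r s :=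
      fun h' => hb (h2.1 h')
    simp [ha, hb, ha', hb']
  · have ha' : ¬ Conn ends (assignX ends x (flipOp ends d r s ρ)) r s := fun h' => ha (h1.1 h')
    have hb' := h2.2 hb
    simp [ha, hb, ha', hb']
  · have ha' : ¬ Conn ends (assignX ends x (flipOp ends d r s ρ)) r s := fun h' => ha (h1.1 h')
    have hb' : ¬ Conn ends (OneColourSwitch.compl (assignX ends x (flipOp ends d r s ρ))) r s :=
      fun h' => hb (h2.1 h')
    simp [ha, hb, ha', hb']

end FlipRS

end NoPocket

end Summit.Ventures.PercRepro2
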